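import Summits.QuantumFields.YangMills.Theorems.LuscherReductionTwistedTraceScalingGaugeSlice
import HarnessLib

/-!
# The gauge-AVERAGED transfer kernel `K̃_β(U,V) = ∫ K_β(U, V^g) dg` and the kernel form of the gauge slice identity
# (lane A of S-BASE, crux `TwistedTraceScaling` stmt-QuantumFields-20203, sub-target C4 INNER; design note `pub/ym-fleet/ym-luscher-20007-p1/COARSE-DESIGN.md` §23)

Sequel of `…GaugeSlice`: `avgKernel β U V = ∫ K_β(U, V^g) dg` (Haar probability on the gauge group `SU(2)^{sites}`) is positive, bounded like `K_β`,
symmetric (`avgKernel_symm`, inversion invariance of Haar), bi-invariant (`avgKernel_gaugeTransform_left/right`), measurable in each argument, and it IS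
the kernel of `gaugeAvg ∘ K_β` (★ `gaugeAvg_transferApply_eq_integral_avgKernel`, Fubini).  Hence the kernel form of the slice identity
(★★ `qform_eq_integral_avgKernel`: `⟨ψ, K_β φ⟩ = ∫∫ f_ψ(U) K̃_β(U,V) f_φ(V)` for the slice functions `f = sliceFn χ ·`) and the one-function package
★★ `slice_package` (`‖ψ‖² = ∫ f² N`, `⟨ψ,K_βψ⟩ = ∫∫ f K̃_β f`, `f` measurable, bounded, supported in `supp χ`): the invariant min–max problem of
`InnerNoIntruderOneOrbitAt` is, EXACTLY, a min–max problem for the bi-invariant kernel `K̃_β` on `L²(supp χ, N dU)` for any admissible weight `χ` —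
the object the Born–Oppenheimer chart of §23 then analyses in the constant-mode tube (Laplace asymptotics of the gauge-orbit integral = Faddeev–Popov
determinant, second order in the slow datum by the symmetry lemma of `…InnerSymmetry`).
HONEST FRAMING: exact symmetry bookkeeping (Fubini + invariance); no kernel estimate; C4 OPEN; conditional route R2b1; not infinite volume, not a gap, not Clay.
-/

set_option autoImplicit false

noncomputable section

open MeasureTheory Filter Topology Real
open scoped BigOperators
open Literature.MathematicalPhysics.QuantumFieldTheory
open Literature.MathematicalPhysics.QuantumLattice

namespace Summit.QuantumFields.YangMills.Theorems.FemtoTransferGap.TwoLattice.Avg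

open Summit.QuantumFields.YangMills.Theorems.FemtoTransferGap

variable {L : ℕ} [NeZero L]

/-! ## §1 The averaged kernel `K̃_β(U,V) = ∫ K_β(U, V^g) dg` -/

/-- **The gauge-averaged transfer kernel** `K̃_β(U,V) = ∫ K_β(U, V^g) dg` (Haar probability on the gauge group): the kernel of
`gaugeAvg ∘ K_β` (`gaugeAvg_transferApply_eq_integral_avgKernel`). [cite: SeilerLNP1982, §3] -/
def avgKernel (β : ℝ) (U V : GaugeConfig 3 L SU2) : ℝ :=
  ∫ g, transferKernel su2Rep β U (gaugeTransform g V) ∂gaugeMeasure L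

/-- `g ↦ K_β(U, V^g)` is measurable. [folklore] -/
theorem measurable_transferKernel_gaugeTransform_right (β : ℝ) (U V : GaugeConfig 3 L SU2) :
    Measurable fun g : Site 3 L → SU2 => transferKernel su2Rep β U (gaugeTransform g V) :=
  (continuous_transferKernel_right β U).measurable.comp (measurable_gaugeTransform_left V)

/-- `g ↦ K_β(U, V^g)` is integrable (bounded measurable on a probability space). [folklore] -/
theorem integrable_transferKernel_gaugeTransform_right (β : ℝ) (U V : GaugeConfig 3 L SU2) :
    Integrable (fun g : Site 3 L → SU2 => transferKernel su2Rep β U (gaugeTransform g V)) (gaugeMeasure L) := by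
  haveI : SecondCountableTopology SU2 := secondCountableTopology_su2
  obtain ⟨M, hM⟩ := exists_transferKernel_le su2Rep continuous_su2Rep β (L := L)
  exact integrable_of_measurable_abs_le _ (measurable_transferKernel_gaugeTransform_right β U V) (C := M) fun g => by
    rw [abs_of_pos (transferKernel_pos su2Rep β _ _)]; exact hM _ _

/-- `K̃_β > 0`. [folklore] -/
theorem avgKernel_pos (β : ℝ) (U V : GaugeConfig 3 L SU2) : 0 < avgKernel β U V := by
  unfold avgKernel
  have hint := integrable_transferKernel_gaugeTransform_right β U V
  refine (integral_pos_iff_support_of_nonneg (fun g => (transferKernel_pos su2Rep β U _).le) hint).mpr ?_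
  have hsupp : Function.support (fun g : Site 3 L → SU2 => transferKernel su2Rep β U (gaugeTransform g V)) = Set.univ := by
    ext g
    simp only [Function.mem_support, ne_eq, Set.mem_univ, iff_true]
    exact (transferKernel_pos su2Rep β U _).ne'
  rw [hsupp, measure_univ]
  exact zero_lt_one

/-- `K̃_β ≤ M` whenever `K_β ≤ M`. [folklore] -/
theorem avgKernel_le (β : ℝ) {M : ℝ} (hM : ∀ U V : GaugeConfig 3 L SU2, transferKernel su2Rep β U V ≤ M) (U V : GaugeConfig 3 L SU2) :
    avgKernel β U V ≤ M := by
  unfold avgKernel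
  have h := integral_mono (integrable_transferKernel_gaugeTransform_right β U V) (integrable_const M) fun g => hM U (gaugeTransform g V)
  simpa [integral_const] using h

/-- `K̃_β` is bounded: `∃ M, 0 < M ∧ K̃_β ≤ M`. [folklore] -/
theorem exists_avgKernel_le (β : ℝ) : ∃ M : ℝ, 0 < M ∧ ∀ U V : GaugeConfig 3 L SU2, avgKernel β U V ≤ M := by
  haveI : SecondCountableTopology SU2 := secondCountableTopology_su2
  obtain ⟨M, hM⟩ := exists_transferKernel_le su2Rep continuous_su2Rep β (L := L)
  refine ⟨M, ?_, fun U V => avgKernel_le β hM U V⟩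
  exact (transferKernel_pos su2Rep β (1 : GaugeConfig 3 L SU2) 1).trans_le (hM 1 1)

/-- `K̃_β` is invariant under gauge transformations of the SECOND argument (right invariance of Haar on the gauge group). [cite: SeilerLNP1982, §3] -/
theorem avgKernel_gaugeTransform_right (β : ℝ) (h : Site 3 L → SU2) (U V : GaugeConfig 3 L SU2) :
    avgKernel β U (gaugeTransform h V) = avgKernel β U V := by
  unfold avgKernel
  simp only [gaugeTransform_gaugeTransform]
  exact integral_mul_right_eq_self (fun g => transferKernel su2Rep β U (gaugeTransform g V)) h

/-- `K̃_β` is invariant under gauge transformations of the FIRST argument (kernel invariance + left invariance of Haar). [cite: SeilerLNP1982, §3] -/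
theorem avgKernel_gaugeTransform_left (β : ℝ) (h : Site 3 L → SU2) (U V : GaugeConfig 3 L SU2) :
    avgKernel β (gaugeTransform h U) V = avgKernel β U V := by
  unfold avgKernel
  have hK : ∀ g : Site 3 L → SU2, transferKernel su2Rep β (gaugeTransform h U) (gaugeTransform g V) =
      transferKernel su2Rep β U (gaugeTransform (h⁻¹ * g) V) := fun g => by
    rw [← transferKernel_gaugeTransform su2Rep β h U (gaugeTransform (h⁻¹ * g) V), gaugeTransform_gaugeTransform,
      ← mul_assoc, mul_inv_cancel, one_mul]
  simp_rw [hK]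
  exact integral_mul_left_eq_self (fun g => transferKernel su2Rep β U (gaugeTransform g V)) h⁻¹

/-- `K̃_β` is symmetric (symmetry of `K_β`, kernel invariance, inversion invariance of Haar on the compact gauge group). [cite: SeilerLNP1982, §3] -/
theorem avgKernel_symm (β : ℝ) (U V : GaugeConfig 3 L SU2) : avgKernel β U V = avgKernel β V U := by
  unfold avgKernel
  have hK : ∀ g : Site 3 L → SU2, transferKernel su2Rep β V (gaugeTransform g U) = transferKernel su2Rep β U (gaugeTransform g⁻¹ V) := fun g =>
    transferKernel_gaugeTransform_right_eq β g V U
  simp_rw [hK]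
  exact (integral_inv_eq_self (fun g : Site 3 L → SU2 => transferKernel su2Rep β U (gaugeTransform g V)) (gaugeMeasure L)).symm

/-- `U ↦ K̃_β(U, V)` is measurable (Fubini measurability). [folklore] -/
theorem measurable_avgKernel_left (β : ℝ) (V : GaugeConfig 3 L SU2) : Measurable fun U : GaugeConfig 3 L SU2 => avgKernel β U V := by
  have h1 : Measurable fun p : GaugeConfig 3 L SU2 × (Site 3 L → SU2) => transferKernel su2Rep β p.1 (gaugeTransform p.2 V) := by
    have hK : (fun p : GaugeConfig 3 L SU2 × (Site 3 L → SU2) => transferKernel su2Rep β p.1 (gaugeTransform p.2 V)) =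
        fun p => transferKernel su2Rep β V (gaugeTransform p.2⁻¹ p.1) := funext fun p => transferKernel_gaugeTransform_right_eq β p.2 p.1 V
    rw [hK]
    exact (continuous_transferKernel_right β V).measurable.comp measurable_gaugeAction_inv
  exact (h1.stronglyMeasurable.integral_prod_right' (ν := gaugeMeasure L)).measurable

/-- `V ↦ K̃_β(U, V)` is measurable. [folklore] -/
theorem measurable_avgKernel_right (β : ℝ) (U : GaugeConfig 3 L SU2) : Measurable fun V : GaugeConfig 3 L SU2 => avgKernel β U V := by
  have h : (fun V : GaugeConfig 3 L SU2 => avgKernel β U V) = fun V => avgKernel β V U := funext fun V => avgKernel_symm β U V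
  rw [h]; exact measurable_avgKernel_left β U

/-- ★ **`gaugeAvg (K_β f) (U) = ∫ K̃_β(U,V) f(V) dV`**: the averaged kernel is the kernel of `gaugeAvg ∘ K_β` (Fubini; invariance of the
a-priori measure moves the gauge transformation from `U` to `V`). [cite: SeilerLNP1982, §3] -/
theorem gaugeAvg_transferApply_eq_integral_avgKernel (β : ℝ) {f : GaugeConfig 3 L SU2 → ℝ} (hf : Measurable f) {C : ℝ} (hC : ∀ U, |f U| ≤ C)
    (U : GaugeConfig 3 L SU2) : gaugeAvg (transferApply β f) U = ∫ V, avgKernel β U V * f V ∂configMeasure SU2 L := by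
  haveI : SecondCountableTopology SU2 := secondCountableTopology_su2
  obtain ⟨M, hM⟩ := exists_transferKernel_le su2Rep continuous_su2Rep β (L := L)
  -- Step 1: `(K f)(U^g) = ∫ K(U, V^{g⁻¹}) f(V) dV`
  have hstep : ∀ g : Site 3 L → SU2, transferApply β f (gaugeTransform g U) =
      ∫ V, transferKernel su2Rep β U (gaugeTransform g⁻¹ V) * f V ∂configMeasure SU2 L := fun g => by
    rw [transferApply_apply]
    refine integral_congr_ae (ae_of_all _ fun V => ?_)
    dsimp only
    rw [← transferKernel_gaugeTransform su2Rep β g⁻¹ (gaugeTransform g U) V, TT.gaugeTransform_inv_gaugeTransform]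
  -- Step 2: Fubini
  have hJ : Measurable fun p : (Site 3 L → SU2) × GaugeConfig 3 L SU2 => transferKernel su2Rep β U (gaugeTransform p.1⁻¹ p.2) * f p.2 := by
    exact ((continuous_transferKernel_right β U).measurable.comp measurable_gaugeAction_inv').mul (hf.comp measurable_snd)
  have hJb : ∀ p : (Site 3 L → SU2) × GaugeConfig 3 L SU2, |transferKernel su2Rep β U (gaugeTransform p.1⁻¹ p.2) * f p.2| ≤ M * C := fun p => by
    rw [abs_mul, abs_of_pos (transferKernel_pos su2Rep β U _)]
    exact mul_le_mul (hM U (gaugeTransform p.1⁻¹ p.2)) (hC p.2) (abs_nonneg _)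
      ((transferKernel_pos su2Rep β U (gaugeTransform p.1⁻¹ p.2)).le.trans (hM U _))
  have hint : Integrable (fun p : (Site 3 L → SU2) × GaugeConfig 3 L SU2 => transferKernel su2Rep β U (gaugeTransform p.1⁻¹ p.2) * f p.2)
      ((gaugeMeasure L).prod (configMeasure SU2 L)) :=
    integrable_of_measurable_abs_le _ hJ hJb
  have hinv : ∀ V : GaugeConfig 3 L SU2, ∫ g, transferKernel su2Rep β U (gaugeTransform g⁻¹ V) ∂gaugeMeasure L = avgKernel β U V :=
    fun V => integral_inv_eq_self (fun g : Site 3 L → SU2 => transferKernel su2Rep β U (gaugeTransform g V)) (gaugeMeasure L)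
  calc gaugeAvg (transferApply β f) U
      = ∫ g, ∫ V, transferKernel su2Rep β U (gaugeTransform g⁻¹ V) * f V ∂configMeasure SU2 L ∂gaugeMeasure L :=
        integral_congr_ae (ae_of_all _ fun g => hstep g)
    _ = ∫ V, ∫ g, transferKernel su2Rep β U (gaugeTransform g⁻¹ V) * f V ∂gaugeMeasure L ∂configMeasure SU2 L :=
        integral_integral_swap hint
    _ = ∫ V, (∫ g, transferKernel su2Rep β U (gaugeTransform g⁻¹ V) ∂gaugeMeasure L) * f V ∂configMeasure SU2 L :=
        integral_congr_ae (ae_of_all _ fun V => integral_mul_const (f V) _)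
    _ = ∫ V, avgKernel β U V * f V ∂configMeasure SU2 L :=
        integral_congr_ae (ae_of_all _ fun V => by dsimp only; rw [hinv V])

/-! ## §2 The slice identity in kernel form -/

/-- ★★ **The gauge slice identity in KERNEL form**: `⟨ψ, K_β φ⟩ = ∫∫ f_ψ(U) K̃_β(U,V) f_φ(V) dU dV` for the slice functions `f = sliceFn χ ·` of
gauge-invariant bounded measurable `ψ, φ` (weight `χ` with `gaugeAvg χ ≥ n₀ > 0` on its support). [cite: SeilerLNP1982, §3] -/
theorem qform_eq_integral_avgKernel (β : ℝ) {χ ψ φ : GaugeConfig 3 L SU2 → ℝ} (hχ : Measurable χ) {Cχ : ℝ} (hCχ : ∀ U, |χ U| ≤ Cχ)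
    {n₀ : ℝ} (hn₀ : 0 < n₀) (hN : ∀ U, χ U ≠ 0 → n₀ ≤ gaugeAvg χ U)
    (hψ : Measurable ψ) {Cψ : ℝ} (hCψ : ∀ U, |ψ U| ≤ Cψ) (hψinv : ∀ (g : Site 3 L → SU2) (U : GaugeConfig 3 L SU2), ψ (gaugeTransform g U) = ψ U)
    (hψcov : ∀ U, ψ U ≠ 0 → gaugeAvg χ U ≠ 0)
    (hφ : Measurable φ) {Cφ : ℝ} (hCφ : ∀ U, |φ U| ≤ Cφ) (hφinv : ∀ (g : Site 3 L → SU2) (U : GaugeConfig 3 L SU2), φ (gaugeTransform g U) = φ U)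
    (hφcov : ∀ U, φ U ≠ 0 → gaugeAvg χ U ≠ 0) :
    qform su2Rep β ψ φ =
      ∫ U, ∫ V, sliceFn χ ψ U * avgKernel β U V * sliceFn χ φ V ∂configMeasure SU2 L ∂configMeasure SU2 L := by
  rw [qform_eq_sliceFn β hχ hCχ hn₀ hN hψ hCψ hψinv hψcov hφ hCφ hφinv hφcov]
  unfold l2
  refine integral_congr_ae (ae_of_all _ fun U => ?_)
  dsimp only
  rw [gaugeAvg_transferApply_eq_integral_avgKernel β (measurable_sliceFn hχ hφ) (abs_sliceFn_le hCχ hCφ hn₀ hN), ← integral_const_mul]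
  refine integral_congr_ae (ae_of_all _ fun V => ?_)
  dsimp only
  ring


/-! ## §3 The package for one invariant function (norm and form together) -/

/-- ★★ **The slice package**: for an idempotent weight `χ` with `N = gaugeAvg χ ≥ n₀ > 0` on `supp χ` and a gauge-invariant bounded measurable `ψ`
vanishing where `N` does, the slice function `f = sliceFn χ ψ` is measurable, bounded by `C_ψ C_χ / n₀`, supported in `supp χ`, and carries
norm and form EXACTLY: `‖ψ‖² = ∫ f² N` and `⟨ψ, K_β ψ⟩ = ∫∫ f(U) K̃_β(U,V) f(V)`. [cite: SeilerLNP1982, §2–3] -/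
theorem slice_package (β : ℝ) {χ ψ : GaugeConfig 3 L SU2 → ℝ} (hχ : Measurable χ) {Cχ : ℝ} (hCχ : ∀ U, |χ U| ≤ Cχ)
    (hχidem : ∀ U, χ U * χ U = χ U) {n₀ : ℝ} (hn₀ : 0 < n₀) (hN : ∀ U, χ U ≠ 0 → n₀ ≤ gaugeAvg χ U)
    (hψ : Measurable ψ) {Cψ : ℝ} (hCψ : ∀ U, |ψ U| ≤ Cψ) (hψinv : ∀ (g : Site 3 L → SU2) (U : GaugeConfig 3 L SU2), ψ (gaugeTransform g U) = ψ U)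
    (hψcov : ∀ U, ψ U ≠ 0 → gaugeAvg χ U ≠ 0) :
    Measurable (sliceFn χ ψ) ∧ (∀ U, |sliceFn χ ψ U| ≤ Cψ * Cχ / n₀) ∧ (∀ U, sliceFn χ ψ U ≠ 0 → χ U ≠ 0) ∧
      l2 ψ ψ = ∫ U, sliceFn χ ψ U ^ 2 * gaugeAvg χ U ∂configMeasure SU2 L ∧
      qform su2Rep β ψ ψ = ∫ U, ∫ V, sliceFn χ ψ U * avgKernel β U V * sliceFn χ ψ V ∂configMeasure SU2 L ∂configMeasure SU2 L := by
  refine ⟨measurable_sliceFn hχ hψ, abs_sliceFn_le hCχ hCψ hn₀ hN, fun U h => (sliceFn_ne_zero h).1, ?_,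
    qform_eq_integral_avgKernel β hχ hCχ hn₀ hN hψ hCψ hψinv hψcov hψ hCψ hψinv hψcov⟩
  rw [l2_eq_integral_sliceFn_mul_weight hχ hCχ hχidem hn₀ hN hψ hCψ hψinv hψcov hψ hCψ hψinv]
  refine integral_congr_ae (ae_of_all _ fun U => ?_)
  dsimp only
  ring

end Summit.QuantumFields.YangMills.Theorems.FemtoTransferGap.TwoLattice.Avg

end
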